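import Summits.QuantumFields.YangMills.Theorems.BalabanLadderROTTiltBracketKernel
import Summits.QuantumFields.YangMills.Theorems.BalabanLadderROTAxisCell
import Summits.QuantumFields.YangMills.Theorems.LangevinControlUVOSLegsFromFemtoAndGapStubLowerCube
import Summits.QuantumFields.YangMills.Theorems.LangevinControlUVOSLegsAtWeakCouplingCStubDensity
import HarnessLib

/-!
# Crux `ROT` (stmt-QuantumFields-20042): the tilt bracket at one cube — geometry of the tilted transversal and kernel oscillations

Helper file of the fleet lead `ym-spine-20042-p1` (generation g4), `--supports stmt-QuantumFields-20042` (count-neutral).  Third file of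
the series p480022 (`…SkewTorusDLR`: DLR on every period cell) → p481311 (`…TiltBracketKernel`: at fixed lattice the tilt bracket is
bounded by boundary-condition oscillations of ONE cube's kernels); prepares `Theorems/BalabanLadderROTTiltBoundaryDecay.lean`
(the tilt bracket `TI` along admissible schemes from exponential decay of boundary influence in units `a`).

* §1 `box_subset_tiltCell_reps`: the centred box of radius `B` consists of representatives of the TILTED torus of side `2L+1`
  (`PythTriple.tiltCell`, fitted class `q ∣ 2L+1`) as soon as `4B < 2L+1`; `exists_abs_ge_of_notMem_box`.
* §2 the per-step cube of radius `R` around the origin (corner `-R`, side `2R+1`, tree vocabulary `cubeEdges`/`depth`/`kerE`):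
  `abs_coord_le_of_apply_ne_zero` (multi-sites seen by a test function of support radius `ρ` have coordinates `≤ ρ/a`),
  `basePoints_subset_box` (edges of the cube, supports of the translated action densities, boundary edges: base points in the box
  of radius `R+1`), and the kernel oscillations of the action density and of its centred products from a boundary-decay input AT ONE
  `β` with an abstract factor `X ≥ 0` (`kernel_osc_curvature`, `kernel_osc_prod`).

Nothing is asserted about the crux; 0 definitions, 0 sorry.
-/

set_option autoImplicit false

noncomputable section

open scoped SchwartzMap BigOperators
open MeasureTheory Filter Topology Metric
open Literature.MathematicalPhysics.QuantumFieldTheory Literature.MathematicalPhysics.QuantumLattice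
open Literature.MathematicalPhysics.AQFT
open Literature.Probability.LatticeModels (box Site mem_box box_mono)
open Summit.QuantumFields.YangMills.Cruxes.OSLegsFromFemtoAndGap.DlrCollarTransfer
open Summit.QuantumFields.YangMills.Cruxes.OSLegsFromFemtoAndGap.DlrCollarTransfer.StubLower (cubeEdges_window le_depth_cube)
open Summit.QuantumFields.YangMills.Cruxes.OSLegsAtWeakCouplingC.Sketch (tendsto_riemann_sum)
open Summit.QuantumFields.YangMills.Cruxes.OSLegsAtWeakCouplingC.Y2Bridge
open Summit.QuantumFields.YangMills.Theorems.OSLegsFromFemtoAndGap (latticeDist mul_norm_le_norm_smul_siteToE)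
open Summit.QuantumFields.YangMills.Theorems.OSLegsFromFemtoAndGap.StubLower
  (curvature_supp_window curvature_shift_supp_window exists_abs_curvature_le exists_near_of_mem_plaquetteEdges_touching)
open Summit.QuantumFields.YangMills.Theorems.NPointIsotropy.Negative (E4)

namespace Summit.QuantumFields.YangMills.Theorems.ROT

open PythTriple

/-! ## §1 Geometry: centred boxes are representatives of the tilted torus -/

/-- **The centred box of radius `B` consists of representatives of the tilted torus of side `2L+1` on the fitted class, provided
`4(B) < 2L+1`**: for `y ∈ [-B, B]⁴` the rotated doubled coordinates `2·(q R_θ y)ᵢ` are bounded by `4qB < (2L+1)q = m q²`. -/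
theorem box_subset_tiltCell_reps (t : PythTriple) {L B : ℕ} (hL : L ∈ fittedClass t.q) (hB : 4 * B < 2 * L + 1) :
    box 4 B ⊆ (t.tiltCell L).reps := by
  intro y hy
  show y ∈ t.window (t.blocks L)
  have hmq : t.blocks L * t.q = 2 * L + 1 := t.blocks_mul_q hL
  have hq : (0 : ℤ) < t.q := by exact_mod_cast t.q_pos
  have hq1 : 1 ≤ t.q := t.q_pos
  have hyB : ∀ j, |y j| ≤ (B : ℤ) := fun j => abs_le.2 ((mem_box.1 hy) j)
  -- the modulus `m q² = (2L+1) q`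
  have hmod : t.modulus (t.blocks L) = ((2 * L + 1 : ℕ) : ℤ) * t.q := by
    unfold PythTriple.modulus
    rw [← hmq]; push_cast; ring
  have h4 : 4 * (t.q : ℤ) * B < t.modulus (t.blocks L) := by
    rw [hmod]
    have : (4 * B : ℤ) < ((2 * L + 1 : ℕ) : ℤ) := by exact_mod_cast hB
    nlinarith
  rw [PythTriple.mem_window]
  refine ⟨mem_box.2 fun j => ?_, fun i => ?_⟩
  · -- `|y j| ≤ B ≤ m q²`
    have hBm : (B : ℤ) ≤ ((t.blocks L * t.q ^ 2 : ℕ) : ℤ) := by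
      have h1 : B ≤ 2 * L + 1 := by omega
      have h2 : 2 * L + 1 ≤ t.blocks L * t.q ^ 2 := by
        rw [pow_two, ← mul_assoc, hmq]
        exact Nat.le_mul_of_pos_right _ t.q_pos
      exact_mod_cast h1.trans h2
    exact abs_le.1 ((hyB j).trans hBm)
  · -- `|2 (rotZ y)ᵢ| ≤ 4 q B < modulus`
    have hp := t.abs_p_le
    have hs := t.abs_s_le
    have hprod : ∀ (u : ℤ) (j : Fin 4), |u| ≤ t.q → |u * y j| ≤ t.q * B := fun u j hu => by
      rw [abs_mul]; exact mul_le_mul hu (hyB j) (abs_nonneg _) hq.le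
    have habs : |2 * t.rotZ y i| ≤ 4 * (t.q : ℤ) * B := by
      fin_cases i
      · show |2 * t.rotZ y 0| ≤ 4 * (t.q : ℤ) * B
        rw [PythTriple.rotZ_apply_zero, abs_mul, abs_two]
        have h := (abs_add_le (t.p * y 0) (t.s * y 1)).trans (add_le_add (hprod t.p 0 hp) (hprod t.s 1 hs))
        linarith
      · show |2 * t.rotZ y 1| ≤ 4 * (t.q : ℤ) * B
        rw [PythTriple.rotZ_apply_one, abs_mul, abs_two]
        have h1 : |-t.s * y 0| ≤ t.q * B := by rw [neg_mul, abs_neg]; exact hprod t.s 0 hs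
        have h := (abs_add_le (-t.s * y 0) (t.p * y 1)).trans (add_le_add h1 (hprod t.p 1 hp))
        linarith
      · show |2 * t.rotZ y 2| ≤ 4 * (t.q : ℤ) * B
        rw [PythTriple.rotZ_apply_two, abs_mul, abs_two]
        have h := hprod (t.q : ℤ) 2 (by rw [Nat.abs_cast])
        nlinarith [abs_nonneg ((t.q : ℤ) * y 2)]
      · show |2 * t.rotZ y 3| ≤ 4 * (t.q : ℤ) * B
        rw [PythTriple.rotZ_apply_three, abs_mul, abs_two]
        have h := hprod (t.q : ℤ) 3 (by rw [Nat.abs_cast])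
        nlinarith [abs_nonneg ((t.q : ℤ) * y 3)]
    have hlt : |2 * t.rotZ y i| < t.modulus (t.blocks L) := lt_of_le_of_lt habs h4
    exact ⟨by linarith [(abs_lt.1 hlt).1], (abs_lt.1 hlt).2⟩

/-- A site outside the centred box of radius `B` has a coordinate of modulus `≥ B + 1`. [folklore] -/
theorem exists_abs_ge_of_notMem_box {B : ℕ} {y : Site 4} (hy : y ∉ box 4 B) : ∃ j, (B : ℤ) + 1 ≤ |y j| := by
  by_contra h
  exact hy (mem_box.2 fun j => abs_le.1 (Int.lt_add_one_iff.1 (not_le.1 (not_exists.1 h j))))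

/-! ## §2 The per-step cube: coordinates, base points, kernel oscillations -/

section Main

variable {G : Type} [Group G] [TopologicalSpace G] [IsTopologicalGroup G] [CompactSpace G]
  [MeasurableSpace G] [BorelSpace G]

/-- Multi-sites seen by a test function supported in the ball of radius `ρ` have coordinates `≤ ρ/a` at spacing `a`. [folklore] -/
theorem abs_coord_le_of_apply_ne_zero {n : ℕ} (F : 𝓢((Fin n → E4), ℂ)) {ρ : ℝ}
    (hρ : tsupport (F : (Fin n → E4) → ℂ) ⊆ closedBall (0 : Fin n → E4) ρ) {a : ℝ} (ha : 0 < a)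
    (x : Fin n → Site 4) (hx : F (fun i => a • siteToE (x i)) ≠ 0) (i : Fin n) (j : Fin 4) :
    |((x i j : ℤ) : ℝ)| ≤ ρ / a := by
  have hy := hρ (subset_tsupport _ (Function.mem_support.2 hx))
  rw [mem_closedBall, dist_zero_right] at hy
  have h2 : a * ‖x i‖ ≤ ρ := (mul_norm_le_norm_smul_siteToE ha.le (x i)).trans ((norm_le_pi_norm _ i).trans hy)
  have h3 : |((x i j : ℤ) : ℝ)| ≤ ‖x i‖ := by rw [← Int.norm_eq_abs]; exact norm_le_pi_norm (x i) j
  rw [le_div_iff₀ ha]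
  nlinarith [abs_nonneg ((x i j : ℤ) : ℝ)]

/-- **Geometry of the per-step cube.**  For the cube of radius `R` around the origin (corner `-R`, side `2R+1`) and an `n`-tuple of sites
with coordinates `≤ R` in modulus, the base points of the cube's edges, of the support of the action density, of its translates to the
`xᵢ` and of the boundary edges `∂Λ` all lie in the centred box of radius `R + 1`. -/
theorem basePoints_subset_box (r : LatticeRep G) (R : ℕ) {n : ℕ} (x : Fin n → Site 4) (hx : ∀ i j, |x i j| ≤ (R : ℤ)) :
    (((cubeEdges (fun j => (0 : Fin 4 → ℤ) j - R) (2 * R + 1) ∪ (r.curvature.supp ∪ Finset.univ.biUnion fun i =>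
          r.curvature.supp.image fun e => (e.1 + x i, e.2)) ∪
        (plaquettesTouching (cubeEdges (fun j => (0 : Fin 4 → ℤ) j - R) (2 * R + 1))).biUnion plaquetteEdges).image
        Prod.fst : Finset (Site 4)) : Set (Site 4)) ⊆ (box 4 (R + 1) : Set (Site 4)) := by
  intro z hz
  rw [Finset.mem_coe, Finset.mem_image] at hz
  obtain ⟨e, he, rfl⟩ := hz
  rw [Finset.mem_coe, mem_box]
  have hcube : ∀ e' ∈ cubeEdges (fun j => (0 : Fin 4 → ℤ) j - R) (2 * R + 1), ∀ j, -(R : ℤ) ≤ e'.1 j ∧ e'.1 j ≤ R :=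
    fun e' he' j => by
      have h := cubeEdges_window 0 R e' he' j
      simp only [Pi.zero_apply, zero_sub, zero_add] at h
      exact h
  suffices h : ∀ j, -((R : ℤ) + 1) ≤ e.1 j ∧ e.1 j ≤ (R : ℤ) + 1 by
    intro j; have := h j; push_cast; exact this
  intro j
  rcases Finset.mem_union.1 he with he1 | he2
  · rcases Finset.mem_union.1 he1 with heΛ | hesupp
    · have := hcube e heΛ j
      constructor <;> linarith [this.1, this.2]
    · rcases Finset.mem_union.1 hesupp with heO | heS
      · have := curvature_supp_window r e heO j
        constructor <;> linarith [this.1, this.2]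
      · obtain ⟨i, -, hei⟩ := Finset.mem_biUnion.1 heS
        obtain ⟨e', he', rfl⟩ := Finset.mem_image.1 hei
        have hw := curvature_supp_window r e' he' j
        have hxi := abs_le.1 (hx i j)
        simp only [Pi.add_apply]
        constructor <;> linarith [hw.1, hw.2, hxi.1, hxi.2]
  · obtain ⟨e', he'Λ, hnear⟩ := exists_near_of_mem_plaquetteEdges_touching he2
    have := hcube e' he'Λ j
    have hn := hnear j
    constructor <;> linarith [hn.1, hn.2, this.1, this.2]

/-- **Kernel oscillation of the action density** from the boundary-decay input at one `β`: for the cube of radius `R` around the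
origin and depth `d ≤ R`, `|γ_Λ(O | η) − γ_Λ(O | η')| ≤ max(K₆,0) · B · b⁴ · X`. -/
theorem kernel_osc_curvature (r : LatticeRep G) (β : ℝ) {K₆ X : ℝ} (hX : 0 ≤ X) (R d : ℕ)
    (hdecβ : ∀ (c : Fin 4 → ℤ) (b : ℕ) (η η' : LGConfig 4 G) (A : LGConfig 4 G → ℝ) (M : ℝ)
      (S : Finset (Literature.MathematicalPhysics.QuantumLattice.ZdEdge 4)),
      Continuous A → (∀ U, |A U| ≤ M) → IsCylinder A S → (∀ e ∈ S, d ≤ depth c b e.1) →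
      |kerE G r β c b η A - kerE G r β c b η' A| ≤ K₆ * M * (b : ℝ) ^ 4 * X)
    {B : ℝ} (hB0 : 0 ≤ B) (hOB : ∀ U, |r.curvature.F U| ≤ B) (hd : d ≤ R) (η η' : LGConfig 4 G) :
    |∫ W, r.curvature.F W ∂(ymSpecification r.ρ β (cubeEdges (fun j => (0 : Fin 4 → ℤ) j - R) (2 * R + 1)) η) -
      ∫ W, r.curvature.F W ∂(ymSpecification r.ρ β (cubeEdges (fun j => (0 : Fin 4 → ℤ) j - R) (2 * R + 1)) η')| ≤
      max K₆ 0 * B * ((2 * R + 1 : ℕ) : ℝ) ^ 4 * X := by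
  haveI := r.secondCountableTopology
  have hOc : Continuous r.curvature.F := PeriodCell.continuous_curvature r
  have hdepth : ∀ e ∈ r.curvature.supp, d ≤ depth (fun j => (0 : Fin 4 → ℤ) j - R) (2 * R + 1) e.1 := by
    intro e he
    have hw := curvature_supp_window r e he
    have hdep := le_depth_cube 0 e.1 R (t := 1) fun j => by
      have := hw j
      rw [abs_le]; simp only [Pi.zero_apply, Int.cast_zero, sub_zero]
      constructor
      · have : (0 : ℝ) ≤ ((e.1 j : ℤ) : ℝ) := by exact_mod_cast this.1
        linarith
      · exact_mod_cast this.2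
    have h' : (d : ℝ) ≤ (depth (fun j => (0 : Fin 4 → ℤ) j - R) (2 * R + 1) e.1 : ℝ) := by
      have h1 : (R : ℝ) + 1 - 1 ≤ depth (fun j => (0 : Fin 4 → ℤ) j - R) (2 * R + 1) e.1 := hdep
      have h2 : (d : ℝ) ≤ R := by exact_mod_cast hd
      linarith
    exact_mod_cast h'
  have h := hdecβ (fun j => (0 : Fin 4 → ℤ) j - R) (2 * R + 1) η η' r.curvature.F B r.curvature.supp hOc hOB
    r.curvature.isCylinder hdepth
  unfold kerE at h
  have hnn : 0 ≤ B * (((2 * R + 1 : ℕ) : ℝ) ^ 4 * X) := by positivity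
  calc _ ≤ K₆ * B * ((2 * R + 1 : ℕ) : ℝ) ^ 4 * X := h
    _ = K₆ * (B * (((2 * R + 1 : ℕ) : ℝ) ^ 4 * X)) := by ring
    _ ≤ max K₆ 0 * (B * (((2 * R + 1 : ℕ) : ℝ) ^ 4 * X)) := mul_le_mul_of_nonneg_right (le_max_left _ _) hnn
    _ = _ := by ring

/-- **Kernel oscillation of the centred products** from the boundary-decay input at one `β`: for the cube of radius `R` around the origin,
an `n`-tuple of sites with coordinates `≤ τ` (real) with `d ≤ R − τ`, and a centring `|m| ≤ B`,
`|γ_Λ(P_m | η) − γ_Λ(P_m | η')| ≤ max(K₆,0) · (2B)ⁿ · b⁴ · X`. -/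
theorem kernel_osc_prod (r : LatticeRep G) (β : ℝ) {K₆ X : ℝ} (hX : 0 ≤ X) (R d : ℕ)
    (hdecβ : ∀ (c : Fin 4 → ℤ) (b : ℕ) (η η' : LGConfig 4 G) (A : LGConfig 4 G → ℝ) (M : ℝ)
      (S : Finset (Literature.MathematicalPhysics.QuantumLattice.ZdEdge 4)),
      Continuous A → (∀ U, |A U| ≤ M) → IsCylinder A S → (∀ e ∈ S, d ≤ depth c b e.1) →
      |kerE G r β c b η A - kerE G r β c b η' A| ≤ K₆ * M * (b : ℝ) ^ 4 * X)
    {B : ℝ} (hB0 : 0 ≤ B) (hOB : ∀ U, |r.curvature.F U| ≤ B) {m : ℝ} (hm : |m| ≤ B) {τ : ℝ}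
    (hdτ : (d : ℝ) ≤ R - τ) {n : ℕ} (x : Fin n → Site 4) (hx : ∀ i j, |((x i j : ℤ) : ℝ)| ≤ τ) (η η' : LGConfig 4 G) :
    |∫ W, (∏ i, (r.curvature.F (configShift (-(x i)) W) - m))
        ∂(ymSpecification r.ρ β (cubeEdges (fun j => (0 : Fin 4 → ℤ) j - R) (2 * R + 1)) η) -
      ∫ W, (∏ i, (r.curvature.F (configShift (-(x i)) W) - m))
        ∂(ymSpecification r.ρ β (cubeEdges (fun j => (0 : Fin 4 → ℤ) j - R) (2 * R + 1)) η')| ≤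
      max K₆ 0 * (2 * B) ^ n * ((2 * R + 1 : ℕ) : ℝ) ^ 4 * X := by
  haveI := r.secondCountableTopology
  have hcyl := PeriodCell.isCylinder_prod_curvature_shift r m x
  have h := hdecβ (fun j => (0 : Fin 4 → ℤ) j - R) (2 * R + 1) η η' _ ((2 * B) ^ n) _
    (PeriodCell.continuous_prod_curvature_shift r m x) (fun U => PeriodCell.abs_prod_centred_le hOB hm x U) hcyl
    (fun e he => by
      obtain ⟨i, -, hei⟩ := Finset.mem_biUnion.1 he
      obtain ⟨e', he', rfl⟩ := Finset.mem_image.1 hei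
      have hw := curvature_supp_window r e' he'
      have hdep := le_depth_cube 0 (e'.1 + x i) R (t := τ + 1) fun j => by
        have h1 := hw j
        have h2 := abs_le.1 (hx i j)
        rw [abs_le]; simp only [Pi.zero_apply, Pi.add_apply, Int.cast_zero, sub_zero, Int.cast_add]
        have h3 : (0 : ℝ) ≤ ((e'.1 j : ℤ) : ℝ) := by exact_mod_cast h1.1
        have h4 : ((e'.1 j : ℤ) : ℝ) ≤ 1 := by exact_mod_cast h1.2
        constructor <;> linarith
      have h' : (d : ℝ) ≤ (depth (fun j => (0 : Fin 4 → ℤ) j - R) (2 * R + 1) (e'.1 + x i) : ℝ) := by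
        have : (R : ℝ) + 1 - (τ + 1) ≤ depth (fun j => (0 : Fin 4 → ℤ) j - R) (2 * R + 1) (e'.1 + x i) := hdep
        linarith
      exact_mod_cast h')
  unfold kerE at h
  have hnn : 0 ≤ (2 * B) ^ n * (((2 * R + 1 : ℕ) : ℝ) ^ 4 * X) := by positivity
  calc _ ≤ K₆ * (2 * B) ^ n * ((2 * R + 1 : ℕ) : ℝ) ^ 4 * X := h
    _ = K₆ * ((2 * B) ^ n * (((2 * R + 1 : ℕ) : ℝ) ^ 4 * X)) := by ring
    _ ≤ max K₆ 0 * ((2 * B) ^ n * (((2 * R + 1 : ℕ) : ℝ) ^ 4 * X)) := mul_le_mul_of_nonneg_right (le_max_left _ _) hnn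
    _ = _ := by ring

end Main

end Summit.QuantumFields.YangMills.Theorems.ROT

end
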